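import Summits.AtomisticToContinuum.Crystallization.Theorems.FreeSplittingCertificatesStrictSplittingRuleTorusParamEnclosure

/-!
# Computable enclosure data for the monomials of the parametrised torus model

The box theorem needs, for every coefficient monomial `t(a,h) = Π atoms` (atoms `a`, `h`, `W′(s_c)`, `W″(s_c)` with
`s_c = σa² + τh²`), an `AffEncl` with RATIONAL data `(c₀, c₁, c₂, ρ)`.  Instead of generating one proof per monomial,
this file COMPUTES the data by `ℚ`-valued functions (`AffQ.mulQ`, `invPowQ`, `Atom.enclQ`, `monoEnclQ`) that mirror
the lemmas of `…TorusParamEnclosure` (`AffEncl.mul`, `AffEncl.invPow_sqLen`, …) and proves ONCE that the computed data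
enclose the real functions (`monoEnclQ_encl`).  The certificate files can then evaluate `monoEnclQ` inside
`native_decide` and the assembly theorem cites `monoEnclQ_encl` — no generated proof text.  [folklore]
-/

namespace Summit.AtomisticToContinuum.Crystallization.Theorems.StrictSplittingRuleTorusLMI

/-- Rational affine-enclosure data `(c₀, c₁, c₂, ρ)`. [folklore] -/
structure AffQ where
  /-- value at the centre -/
  c₀ : ℚ
  /-- `∂/∂a` coefficient -/
  c₁ : ℚ
  /-- `∂/∂h` coefficient -/
  c₂ : ℚ
  /-- radius -/
  ρ : ℚ
  deriving DecidableEq, Repr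

namespace AffQ

/-- The enclosure predicate with rational data. [folklore] -/
def Encl (a₀ h₀ Δ : ℚ) (e : AffQ) (f : ℝ → ℝ → ℝ) : Prop :=
  AffEncl (a₀ : ℝ) h₀ Δ f e.c₀ e.c₁ e.c₂ e.ρ

/-- Constant. [folklore] -/
def const (c : ℚ) : AffQ := ⟨c, 0, 0, 0⟩

/-- Product data (the formula of `AffEncl.mul`). [folklore] -/
def mulQ (Δ : ℚ) (e e' : AffQ) : AffQ :=
  ⟨e.c₀ * e'.c₀, e.c₀ * e'.c₁ + e.c₁ * e'.c₀, e.c₀ * e'.c₂ + e.c₂ * e'.c₀,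
    (|e.c₁| + |e.c₂|) * (|e'.c₁| + |e'.c₂|) * Δ ^ 2 + e.ρ * (|e'.c₀| + (|e'.c₁| + |e'.c₂|) * Δ) +
      e'.ρ * (|e.c₀| + (|e.c₁| + |e.c₂|) * Δ) + e.ρ * e'.ρ⟩

/-- Linear combination data `k • e + k' • e'`. [folklore] -/
def lin (k : ℚ) (e : AffQ) (k' : ℚ) (e' : AffQ) : AffQ :=
  ⟨k * e.c₀ + k' * e'.c₀, k * e.c₁ + k' * e'.c₁, k * e.c₂ + k' * e'.c₂, |k| * e.ρ + |k'| * e'.ρ⟩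

variable {a₀ h₀ Δ : ℚ}

/-- `const` is correct. [folklore] -/
theorem const_encl (c : ℚ) : (const c).Encl a₀ h₀ Δ (fun _ _ => (c : ℝ)) := by
  intro a h _ _; simp [const]

/-- `mulQ` is correct (`AffEncl.mul`). [folklore] -/
theorem mulQ_encl (hΔ : 0 ≤ Δ) {e e' : AffQ} {f g : ℝ → ℝ → ℝ} (he : e.Encl a₀ h₀ Δ f) (he' : e'.Encl a₀ h₀ Δ g) :
    (mulQ Δ e e').Encl a₀ h₀ Δ (fun a h => f a h * g a h) := by
  have h := AffEncl.mul (by exact_mod_cast hΔ) he he'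
  simp only [Encl, mulQ]
  push_cast
  exact h

/-- `lin` is correct (`AffEncl.smul` + `AffEncl.add`). [folklore] -/
theorem lin_encl (k : ℚ) {e : AffQ} (k' : ℚ) {e' : AffQ} {f g : ℝ → ℝ → ℝ} (he : e.Encl a₀ h₀ Δ f)
    (he' : e'.Encl a₀ h₀ Δ g) :
    (lin k e k' e').Encl a₀ h₀ Δ (fun a h => (k : ℝ) * f a h + (k' : ℝ) * g a h) := by
  have h := AffEncl.add (AffEncl.smul (k : ℝ) he) (AffEncl.smul (k' : ℝ) he')
  simp only [Encl, lin]
  push_cast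
  exact h

end AffQ

/-- Enclosure data of `(σa² + τh²)⁻ⁿ` (the formulas of `AffEncl.invPow_sqLen`, with `lo, hi` the exact extreme squared
lengths on the box and `ρ = max r₁ r₂`). [folklore] -/
def invPowQ (a₀ h₀ Δ : ℚ) (n : ℕ) (σ τ : ℚ) : AffQ :=
  let lo := σ * (a₀ - Δ) ^ 2 + τ * (h₀ - Δ) ^ 2
  let hi := σ * (a₀ + Δ) ^ 2 + τ * (h₀ + Δ) ^ 2
  let m := σ * a₀ ^ 2 + τ * h₀ ^ 2
  let κ := (hi⁻¹ ^ n - lo⁻¹ ^ n) / (hi - lo)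
  let G := 2 * σ * a₀ + 2 * τ * h₀
  let D₀ := lo⁻¹ ^ n + κ * (m - lo) - m⁻¹ ^ n
  let D₁ := κ + n * m⁻¹ ^ (n + 1)
  let r₁ := n * m⁻¹ ^ (n + 1) * ((σ + τ) * Δ ^ 2)
  let r₂ := D₀ + |D₁| * (G * Δ)
  ⟨m⁻¹ ^ n, -(n * m⁻¹ ^ (n + 1) * (2 * σ * a₀)), -(n * m⁻¹ ^ (n + 1) * (2 * τ * h₀)), max r₁ r₂⟩

/-- `invPowQ` is correct whenever the class is nondegenerate (`0 < σ(a₀−Δ)² + τ(h₀−Δ)²`, with `σ, τ ≥ 0`,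
`0 < Δ ≤ a₀, h₀`). [folklore] -/
theorem invPowQ_encl {a₀ h₀ Δ σ τ : ℚ} (n : ℕ) (hσ : 0 ≤ σ) (hτ : 0 ≤ τ) (hΔ : 0 < Δ) (ha : Δ ≤ a₀) (hh : Δ ≤ h₀)
    (hlo : 0 < σ * (a₀ - Δ) ^ 2 + τ * (h₀ - Δ) ^ 2) :
    (invPowQ a₀ h₀ Δ n σ τ).Encl a₀ h₀ Δ (fun a h => ((σ : ℝ) * a ^ 2 + τ * h ^ 2)⁻¹ ^ n) := by
  have hlh : σ * (a₀ - Δ) ^ 2 + τ * (h₀ - Δ) ^ 2 < σ * (a₀ + Δ) ^ 2 + τ * (h₀ + Δ) ^ 2 := by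
    have h1 : (a₀ - Δ) ^ 2 < (a₀ + Δ) ^ 2 := by nlinarith
    have h2 : (h₀ - Δ) ^ 2 < (h₀ + Δ) ^ 2 := by nlinarith
    rcases hσ.lt_or_eq with hσ' | hσ'
    · nlinarith
    · rcases hτ.lt_or_eq with hτ' | hτ'
      · nlinarith
      · exfalso; rw [← hσ', ← hτ'] at hlo; simp at hlo
  have h := AffEncl.invPow_sqLen (a₀ := (a₀ : ℝ)) (h₀ := (h₀ : ℝ)) (Δ := (Δ : ℝ)) n
    (σ := (σ : ℝ)) (τ := (τ : ℝ))
    (lo := ((σ * (a₀ - Δ) ^ 2 + τ * (h₀ - Δ) ^ 2 : ℚ) : ℝ))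
    (hi := ((σ * (a₀ + Δ) ^ 2 + τ * (h₀ + Δ) ^ 2 : ℚ) : ℝ))
    (ρ := ((invPowQ a₀ h₀ Δ n σ τ).ρ : ℝ))
    (m := ((σ * a₀ ^ 2 + τ * h₀ ^ 2 : ℚ) : ℝ))
    (κ := ((((σ * (a₀ + Δ) ^ 2 + τ * (h₀ + Δ) ^ 2)⁻¹ ^ n - (σ * (a₀ - Δ) ^ 2 + τ * (h₀ - Δ) ^ 2)⁻¹ ^ n) /
        ((σ * (a₀ + Δ) ^ 2 + τ * (h₀ + Δ) ^ 2) - (σ * (a₀ - Δ) ^ 2 + τ * (h₀ - Δ) ^ 2)) : ℚ) : ℝ))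
    (G := ((2 * σ * a₀ + 2 * τ * h₀ : ℚ) : ℝ))
    (D₀ := (((σ * (a₀ - Δ) ^ 2 + τ * (h₀ - Δ) ^ 2)⁻¹ ^ n +
        (((σ * (a₀ + Δ) ^ 2 + τ * (h₀ + Δ) ^ 2)⁻¹ ^ n - (σ * (a₀ - Δ) ^ 2 + τ * (h₀ - Δ) ^ 2)⁻¹ ^ n) /
          ((σ * (a₀ + Δ) ^ 2 + τ * (h₀ + Δ) ^ 2) - (σ * (a₀ - Δ) ^ 2 + τ * (h₀ - Δ) ^ 2))) *
          ((σ * a₀ ^ 2 + τ * h₀ ^ 2) - (σ * (a₀ - Δ) ^ 2 + τ * (h₀ - Δ) ^ 2)) - (σ * a₀ ^ 2 + τ * h₀ ^ 2)⁻¹ ^ n : ℚ) : ℝ))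
    (D₁ := (((((σ * (a₀ + Δ) ^ 2 + τ * (h₀ + Δ) ^ 2)⁻¹ ^ n - (σ * (a₀ - Δ) ^ 2 + τ * (h₀ - Δ) ^ 2)⁻¹ ^ n) /
          ((σ * (a₀ + Δ) ^ 2 + τ * (h₀ + Δ) ^ 2) - (σ * (a₀ - Δ) ^ 2 + τ * (h₀ - Δ) ^ 2))) +
          n * (σ * a₀ ^ 2 + τ * h₀ ^ 2)⁻¹ ^ (n + 1) : ℚ) : ℝ))
    (by exact_mod_cast hσ) (by exact_mod_cast hτ) (by exact_mod_cast ha) (by exact_mod_cast hh)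
    (by exact_mod_cast hlo) (by exact_mod_cast hlh) (by push_cast; exact le_rfl) (by push_cast; exact le_rfl)
    (by push_cast; ring) (by push_cast; ring) (by push_cast; ring) (by push_cast; ring) (by push_cast; ring)
    (by
      simp only [invPowQ]
      push_cast
      exact le_max_left _ _)
    (by
      simp only [invPowQ]
      push_cast
      exact le_max_right _ _)
  simp only [AffQ.Encl, invPowQ]
  push_cast
  simp only [invPowQ] at h
  push_cast at h
  exact h

/-- The coefficient ATOMS of the model: `a`, `h`, and the two LJ weights at the squared length of class `(σ, τ)`:
`W′(s) = ½(s⁻⁴ − s⁻⁷)`, `W″(s) = ½(7s⁻⁸ − 4s⁻⁵)`. [folklore] -/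
inductive Atom where
  | a : Atom
  | h : Atom
  | w1 (σ τ : ℚ) : Atom
  | w2 (σ τ : ℚ) : Atom
  deriving DecidableEq, Repr

namespace Atom

/-- Real value of an atom at `(a,h)`. [folklore] -/
noncomputable def val : Atom → ℝ → ℝ → ℝ
  | .a => fun a _ => a
  | .h => fun _ h => h
  | .w1 σ τ => fun a h => ((1 / 2 : ℚ) : ℝ) * ((σ : ℝ) * a ^ 2 + τ * h ^ 2)⁻¹ ^ 4 +
      ((-1 / 2 : ℚ) : ℝ) * ((σ : ℝ) * a ^ 2 + τ * h ^ 2)⁻¹ ^ 7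
  | .w2 σ τ => fun a h => ((7 / 2 : ℚ) : ℝ) * ((σ : ℝ) * a ^ 2 + τ * h ^ 2)⁻¹ ^ 8 +
      ((-2 : ℚ) : ℝ) * ((σ : ℝ) * a ^ 2 + τ * h ^ 2)⁻¹ ^ 5

/-- Computed enclosure data of an atom. [folklore] -/
def enclQ (a₀ h₀ Δ : ℚ) : Atom → AffQ
  | .a => ⟨a₀, 1, 0, 0⟩
  | .h => ⟨h₀, 0, 1, 0⟩
  | .w1 σ τ => AffQ.lin (1 / 2) (invPowQ a₀ h₀ Δ 4 σ τ) (-1 / 2) (invPowQ a₀ h₀ Δ 7 σ τ)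
  | .w2 σ τ => AffQ.lin (7 / 2) (invPowQ a₀ h₀ Δ 8 σ τ) (-2) (invPowQ a₀ h₀ Δ 5 σ τ)

/-- Side condition of an atom (nondegenerate nonnegative class). [folklore] -/
def ok (a₀ h₀ Δ : ℚ) : Atom → Bool
  | .a => true
  | .h => true
  | .w1 σ τ => decide (0 ≤ σ) && decide (0 ≤ τ) && decide (0 < σ * (a₀ - Δ) ^ 2 + τ * (h₀ - Δ) ^ 2)
  | .w2 σ τ => decide (0 ≤ σ) && decide (0 ≤ τ) && decide (0 < σ * (a₀ - Δ) ^ 2 + τ * (h₀ - Δ) ^ 2)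

/-- `enclQ` is correct for every admissible atom. [folklore] -/
theorem enclQ_encl {a₀ h₀ Δ : ℚ} (hΔ : 0 < Δ) (ha : Δ ≤ a₀) (hh : Δ ≤ h₀) :
    ∀ x : Atom, x.ok a₀ h₀ Δ = true → (x.enclQ a₀ h₀ Δ).Encl a₀ h₀ Δ x.val
  | .a, _ => by intro a h _ _; simp [enclQ, val]
  | .h, _ => by intro a h _ _; simp [enclQ, val]
  | .w1 σ τ, hok => by
      simp only [ok, Bool.and_eq_true, decide_eq_true_eq] at hok
      obtain ⟨⟨hσ, hτ⟩, hlo⟩ := hok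
      exact AffQ.lin_encl (1 / 2) (-1 / 2) (invPowQ_encl 4 hσ hτ hΔ ha hh hlo) (invPowQ_encl 7 hσ hτ hΔ ha hh hlo)
  | .w2 σ τ, hok => by
      simp only [ok, Bool.and_eq_true, decide_eq_true_eq] at hok
      obtain ⟨⟨hσ, hτ⟩, hlo⟩ := hok
      exact AffQ.lin_encl (7 / 2) (-2) (invPowQ_encl 8 hσ hτ hΔ ha hh hlo) (invPowQ_encl 5 hσ hτ hΔ ha hh hlo)

end Atom

/-- Real value of a monomial (product of atoms). [folklore] -/
noncomputable def monoVal (m : List Atom) (a h : ℝ) : ℝ := (m.map fun x => x.val a h).prod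

/-- Computed enclosure data of a monomial (left fold of `mulQ`). [folklore] -/
def monoEnclQ (a₀ h₀ Δ : ℚ) (m : List Atom) : AffQ :=
  m.foldl (fun e x => AffQ.mulQ Δ e (x.enclQ a₀ h₀ Δ)) (AffQ.const 1)

/-- Helper: folding from any correctly enclosed accumulator. [folklore] -/
theorem monoEnclQ_encl_aux {a₀ h₀ Δ : ℚ} (hΔ : 0 < Δ) (ha : Δ ≤ a₀) (hh : Δ ≤ h₀) :
    ∀ (m : List Atom) (e : AffQ) (f : ℝ → ℝ → ℝ), (∀ x ∈ m, x.ok a₀ h₀ Δ = true) → e.Encl a₀ h₀ Δ f →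
      (m.foldl (fun e x => AffQ.mulQ Δ e (x.enclQ a₀ h₀ Δ)) e).Encl a₀ h₀ Δ
        (fun a h => f a h * (m.map fun x => x.val a h).prod)
  | [], e, f, _, he => by simpa using he
  | x :: m, e, f, hok, he => by
      have hx := Atom.enclQ_encl hΔ ha hh x (hok x (by simp))
      have hstep := AffQ.mulQ_encl hΔ.le he hx
      have ih := monoEnclQ_encl_aux hΔ ha hh m _ _ (fun y hy => hok y (by simp [hy])) hstep
      have hfun : (fun a h => f a h * ((x :: m).map fun y => y.val a h).prod)
          = fun a h => f a h * x.val a h * (m.map fun y => y.val a h).prod := by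
        funext a h; simp [mul_assoc]
      rw [List.foldl_cons, hfun]
      exact ih

/-- **`monoEnclQ` is correct**: for every monomial whose atoms are admissible, the computed rational data enclose the
real monomial value on the box. [folklore] -/
theorem monoEnclQ_encl {a₀ h₀ Δ : ℚ} (hΔ : 0 < Δ) (ha : Δ ≤ a₀) (hh : Δ ≤ h₀) (m : List Atom)
    (hok : ∀ x ∈ m, x.ok a₀ h₀ Δ = true) : (monoEnclQ a₀ h₀ Δ m).Encl a₀ h₀ Δ (monoVal m) := by
  have h := monoEnclQ_encl_aux hΔ ha hh m (AffQ.const 1) (fun _ _ => ((1 : ℚ) : ℝ)) hok (AffQ.const_encl 1)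
  have hfun : monoVal m = fun a h => ((1 : ℚ) : ℝ) * (m.map fun y => y.val a h).prod := by
    funext a h; simp [monoVal]
  unfold monoEnclQ
  rw [hfun]
  exact h

/- Sanity evaluation (scratch, `native_decide`, not landed to keep the axiom set standard):
`(monoEnclQ (97129/100000) (39647/50000) (1/10000) [Atom.a, Atom.a, Atom.w2 1 0]).ρ < 1/50000` — the computed radius of
the first-shell in-plane monomial `a²·W″(a²)` is `≈ 1.1·10⁻⁵`, second order in the box width (symmodel.py agrees). -/

end Summit.AtomisticToContinuum.Crystallization.Theorems.StrictSplittingRuleTorusLMI
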